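import Summits.HodgeConjecture.HodgeConjecture.Theses.AnchorTransport
import Summits.HodgeConjecture.HodgeConjecture.Theorems.AnchorTransportTargetIffHodgeConjecture
import Summits.HodgeConjecture.HodgeConjecture.Theorems.PadicSemiregularLiftHodgeBeyondAnchorsProductsNotAnchors

/-!
# `AnchorExistence` (stmt-HodgeConjecture-1077) · Negative · the constant-family clause is exactly HC at `(X, c)`

Negative knowledge for the crux `AnchorTransport.AnchorExistence` (route AnchorTransport, rank 3), from
the standing disprover's work file `Cruxes/AnchorExistence/Disproof.lean` (§3).  The crux's docstring
says "trivially true when `c` is already algebraic (constant family)"; this file makes the converse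
precise, so that nobody mistakes the clause for slack: an anchor datum with `s₀ = s₁`
(`mem_algebraicClasses_of_anchor_of_eq`), or over any base with a single complex point
(`mem_algebraicClasses_of_anchor_of_subsingleton`, e.g. `Spec ℂ`: the tree's
`HodgeBeyondAnchors.subsingleton_complexPoints_specOver`),
forces `c` to be algebraic on `X` already; hence an anchor datum OVER `Spec ℂ` exists iff `c` is
algebraic (`anchor_over_specOver_iff`).  With the companion file `IsotrivialStrengthening` (`s₁ ≠ s₀`
is achievable isotrivially under HC) and the prover's
`anchorTransport_mem_algebraicClasses_of_anchor_of_fiberIso`, the only content of the crux separable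
from the Hodge conjecture sits in anchors whose fibre is not compatibly isomorphic to `X`.
Refuter seat refuter-cdisprove-stmt-HodgeConjecture-1077-0 (cdisprove cycle 1), 2026-08-16.
-/

noncomputable section

-- The mandated namespace `Summit.<P>.<Sub>.Theorems.…` repeats `HodgeConjecture` (single-conjunct summit).
set_option linter.dupNamespace false

namespace Summit.HodgeConjecture.HodgeConjecture.Theorems.AnchorExistence.Negative.ConstantClause

open CategoryTheory AlgebraicGeometry
open Literature.AlgebraicGeometry Literature.AlgebraicGeometry.Motives
  Literature.AlgebraicGeometry.HodgeTheory Literature.AlgebraicTopology.SingularHomology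

variable {n p : ℕ} {X 𝒳 S : SchemeOver ℂ} {c : complexBetti X (2 * p)}

/-- **Anchoring at the fibre that carries `c` gives nothing**: in an anchor datum with `s₀ = s₁` the
class `c = e^*(A|_{𝒳_{s₁}})` is already algebraic (the route's proved `IsoInvariance` along `e`).
[cite: Fulton1998, §19.1] -/
theorem mem_algebraicClasses_of_anchor_of_eq (f : 𝒳 ⟶ S) (s₁ s₀ : ComplexPoints S)
    (e : X ≅ fiberOver f s₁) (A : complexBetti 𝒳 (2 * p))
    (hAc : complexBetti.map e.hom (2 * p) (complexBetti.map (fiberι f s₁) (2 * p) A) = c)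
    (hs₀ : complexBetti.map (fiberι f s₀) (2 * p) A ∈ algebraicClasses (fiberOver f s₀) p)
    (h : s₀ = s₁) : c ∈ algebraicClasses X p := by
  subst h
  rw [← hAc]
  exact anchorTransport_isoInvariance_proof e p _ hs₀

/-- **Over a base with a single complex point an anchor datum forces `c` algebraic.**
[cite: Fulton1998, §19.1] -/
theorem mem_algebraicClasses_of_anchor_of_subsingleton [Subsingleton (ComplexPoints S)] (f : 𝒳 ⟶ S)
    (s₁ s₀ : ComplexPoints S) (e : X ≅ fiberOver f s₁) (A : complexBetti 𝒳 (2 * p))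
    (hAc : complexBetti.map e.hom (2 * p) (complexBetti.map (fiberι f s₁) (2 * p) A) = c)
    (hs₀ : complexBetti.map (fiberι f s₀) (2 * p) A ∈ algebraicClasses (fiberOver f s₀) p) :
    c ∈ algebraicClasses X p :=
  mem_algebraicClasses_of_anchor_of_eq f s₁ s₀ e A hAc hs₀ (Subsingleton.elim _ _)

/-- **The constant-family clause of the crux is EXACTLY the Hodge conjecture at `(X, c)`**: for a
rational `(p,p)` class `c` on a smooth projective `X`, an anchor datum over the base `Spec ℂ` exists iff
`c` is algebraic (`→`: `Spec ℂ` has one complex point, `HodgeBeyondAnchors.subsingleton_complexPoints_specOver`;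
`←`: the constant family `X ⟶ Spec ℂ` with
`A = c`, fibre isos `isIso_fiberι_toSpecOver`, as in `anchorTransport_anchor_of_mem_algebraicClasses`).
[cite: CharlesSchnell2014Notes, Conj. 11.3.1] -/
theorem anchor_over_specOver_iff (hX : IsSmoothProjective n X) (hc : IsRationalClass c)
    (hpp : IsOfHodgeType n X (2 * p) p p c) :
    (∃ (𝒳 : SchemeOver ℂ) (f : 𝒳 ⟶ specOver ℂ ℂ) (s₁ s₀ : ComplexPoints (specOver ℂ ℂ))
      (e : X ≅ fiberOver f s₁) (A : complexBetti 𝒳 (2 * p)),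
      IsSmoothProjectiveFamily f n ∧ IrreducibleSpace (specOver ℂ ℂ).left ∧
      AlgebraicGeometry.Smooth (specOver ℂ ℂ).hom ∧
      (∀ s : ComplexPoints (specOver ℂ ℂ), IsRationalClass (complexBetti.map (fiberι f s) (2 * p) A) ∧
        IsOfHodgeType n (fiberOver f s) (2 * p) p p (complexBetti.map (fiberι f s) (2 * p) A)) ∧
      complexBetti.map e.hom (2 * p) (complexBetti.map (fiberι f s₁) (2 * p) A) = c ∧
      complexBetti.map (fiberι f s₀) (2 * p) A ∈ algebraicClasses (fiberOver f s₀) p) ↔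
    c ∈ algebraicClasses X p := by
  haveI := HodgeBeyondAnchors.subsingleton_complexPoints_specOver
  refine ⟨fun ⟨𝒳, f, s₁, s₀, e, A, _, _, _, _, hAc, hs₀⟩ ↦
    mem_algebraicClasses_of_anchor_of_subsingleton f s₁ s₀ e A hAc hs₀, fun halg ↦ ?_⟩
  haveI : ∀ s : AlgPoints (specOver ℂ ℂ) ℂ, IsIso (fiberι (toSpecOver X) s) := isIso_fiberι_toSpecOver
  refine ⟨X, toSpecOver X, 𝟙 _, 𝟙 _, (asIso (fiberι (toSpecOver X) (𝟙 _))).symm, c,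
    isSmoothProjectiveFamily_toSpecOver hX, irreducibleSpace_specOver_left, smooth_specOver_hom,
    fun s ↦ ⟨hc.pullback _, hpp.map_of_iso (asIso (fiberι (toSpecOver X) s))⟩, ?_, ?_⟩
  · change (complexBetti.map (asIso (fiberι (toSpecOver X) (𝟙 _))).hom (2 * p) ≫
      complexBetti.map (asIso (fiberι (toSpecOver X) (𝟙 _))).inv (2 * p)) c = c
    rw [← complexBetti.map_comp, Iso.inv_hom_id, complexBetti.map_id]
    rfl
  · exact anchorTransport_isoInvariance_proof (asIso (fiberι (toSpecOver X) (𝟙 _))) p _ halg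

end Summit.HodgeConjecture.HodgeConjecture.Theorems.AnchorExistence.Negative.ConstantClause

end
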